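import Summits.NavierStokesRegularity.NavierStokesRegularity.Theorems.ExtremiserTransienceNearExtremalTransienceDSSLogMean
import HarnessLib

/-!
# Route `ExtremiserTransience`, crux `NearExtremalTransience` (stmt-NavierStokesRegularity-21883):
# THE DSS STRATUM FLOW BY FLOW — if `κ⋆` is not attained, every DSS flow is log-mean sub-extremal

`--supports stmt-NavierStokesRegularity-21883` (route-independent). Author: prover seat `ns-et-p1` (g2), on
`…SharpConstant` (`κ⋆ = sInf V` is universal), `…Scaling` (log-periodicity of the efficiency along DSS flows) and
`…DSSLogMean` (log-mean = period average on the DSS stratum).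

Write `κ⋆ = sInf V` (spelled out below). NON-ATTAINMENT of the sharp depletion inequality is the hypothesis
`hna`: for every admissible field `v` (`C^∞`, divergence free, `|v| ≤ M`, bounded gradient, `D⁰v, D¹v, D²v ∈ L²`)
with `M·‖curl v‖₂·‖∇curl v‖₂ > 0` the inequality is STRICT, `|∫⟪ω, Dv ω⟫| < κ⋆·M·‖ω‖₂·‖∇ω‖₂` (equivalently:
no admissible `v` realises `R[v] = κ⋆`; an open STATIC variational question, independent of blow-up).

* `minimalCoeff_lt_sharp_of_notAttained` — under `hna`, along every classical Leray–Hopf rapidly-decaying-datum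
  flow on `[0,T)` every minimal flow-wise coefficient satisfies `k₀(t) < κ⋆` for all `t ∈ [0,T)` (slices are
  admissible by the Tao cover; the efficiency at the least bound `sup|u(t)|` is an admissible constant at `t`).
* `dss_periodMass_lt_of_notAttained` — under `hna`, along a flow DSS about `T` (factor `c > 1`) the period mass is
  strictly sub-extremal: `I₀ = ∫_{t₁}^{T−(T−t₁)/c²} k₀²/(T−τ) < κ⋆²·log(c²)`.
* `dss_perFlow_logMean_of_notAttained` — **hence, flow by flow, the BC5 rung's conclusion holds with SOME
  `θ_u < 1`**: `∃ θ ∈ [0,1), ∀ t ∈ [t₁,T), ∫_{t₁}^t k₀²/(T−τ) ≤ (θκ⋆)²·log((T−t₁)/(T−t)) + I₀`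
  (`θ² κ⋆² = I₀/log(c²)`, `logMean_le_periodAverage_of_dss`).

So on the DSS stratum the crux splits into two named residues: (i) ATTAINMENT of `κ⋆` (if `κ⋆` is attained, a
DSS profile sitting on a maximiser at a.e. phase is the only way a single DSS flow can fail), and (ii) UNIFORMITY of
`θ_u` over all DSS Type-I singular flows (no compactness is available). WHAT THIS IS NOT: `hna` is not proved or
refuted; no DSS blow-up is constructed or excluded; the crux, its BC5 rung, the route and the summit stay open;
Navier–Stokes regularity is NOT proved. [folklore]
-/

noncomputable section

open Set Filter Topology MeasureTheory
open scoped InnerProductSpace RealInnerProductSpace ENNReal NNReal ContDiff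
open Literature.Analysis.FluidPDE

namespace Summit.NavierStokesRegularity.NavierStokesRegularity.Theorems

-- the problem directory repeats the summit name (`NavierStokesRegularity/NavierStokesRegularity`)
set_option linter.dupNamespace false

namespace DepletionLadder

open Summit.NavierStokesRegularity.NavierStokesRegularity.Theorems.RungReynoldsOne

/-- **Under non-attainment of `κ⋆`, minimal coefficients are strictly below `κ⋆`.** Let `u` be a classical
solution of the unforced Navier–Stokes system on `ℝ³ × [0,T)` (`ν, T > 0`), Leray–Hopf from its rapidly decaying
datum, and `k₀ ≥ 0` minimal at every `t ∈ [0,T)` (below every nonnegative constant satisfying the flow-wise clause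
at `t`). If the sharp depletion inequality is never attained (`hna`), then `k₀(t) < κ⋆` for every `t ∈ [0,T)`: the
slice `u(t)` is admissible (Tao cover on `[0,(t+T)/2]`), its least bound `N(t) = sup|u(t)|` exists
(`exists_measurable_supNorm_slice`), and the constant `|J|/(N‖ω‖₂‖∇ω‖₂) < κ⋆` (or `0` in the degenerate case)
satisfies the clause at `t`. [folklore] -/
theorem minimalCoeff_lt_sharp_of_notAttained
    (hna : (∀ (v : EuclideanSpace ℝ (Fin 3) → EuclideanSpace ℝ (Fin 3)) (M B : ℝ), ContDiff ℝ (⊤ : ℕ∞) v → Literature.Analysis.FluidPDE.VectorCalculus.IsDivFree v → (∀ x, ‖v x‖ ≤ M) → (∀ x, ‖fderiv ℝ v x‖ ≤ B) → (∫⁻ x, ‖iteratedFDeriv ℝ 0 v x‖ₑ ^ 2 < ⊤) → (∫⁻ x, ‖iteratedFDeriv ℝ 1 v x‖ₑ ^ 2 < ⊤) → (∫⁻ x, ‖iteratedFDeriv ℝ 2 v x‖ₑ ^ 2 < ⊤) → 0 < M * Real.sqrt (∫ x, ‖curl v x‖ ^ 2) * Real.sqrt (∫ x, frobeniusNormSq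 (fderiv ℝ (curl v) x)) → |∫ x, ⟪curl v x, fderiv ℝ v x (curl v x)⟫_ℝ| < (sInf {κ : ℝ | (∀ (v : EuclideanSpace ℝ (Fin 3) → EuclideanSpace ℝ (Fin 3)) (M B : ℝ), ContDiff ℝ (⊤ : ℕ∞) v → Literature.Analysis.FluidPDE.VectorCalculus.IsDivFree v → (∀ x, ‖v x‖ ≤ M) → (∀ x, ‖fderiv ℝ v x‖ ≤ B) → (∫⁻ x, ‖iteratedFDeriv ℝ 0 v x‖ₑ ^ 2 < ⊤) → (∫⁻ x, ‖iteratedFDeriv ℝ 1 v x‖ₑ ^ 2 < ⊤) → (∫⁻ x, ‖iteratedFDeriv ℝ 2 v x‖ₑ ^ 2 < ⊤) → |∫ x, ⟪Literature.Analysis.FluidPDE.curl v x, fderiv ℝ v x (Literature.Analysis.FluidPDE.curl v x)⟫_ℝ| ≤ κ * M * Real.sqrt (∫ x, ‖Literature.Analysis.FluidPDE.curl v x‖ ^ 2) * Real.sqrt (∫ x, Literature.Analysis.FluidPDE.frobeniusNormSq (fderiv ℝ (Literature.Analysis.FluidPDE.curl v) x)))}) * M * Real.sqrt (∫ x, ‖curl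 v x‖ ^ 2) * Real.sqrt (∫ x, frobeniusNormSq (fderiv ℝ (curl v) x))))
    {ν T : ℝ} (hν : 0 < ν) (hT : 0 < T)
    {u : ℝ → EuclideanSpace ℝ (Fin 3) → EuclideanSpace ℝ (Fin 3)} {p : ℝ → EuclideanSpace ℝ (Fin 3) → ℝ}
    (hsol : IsClassicalNSSolutionOn (Ico 0 T) ν 0 u p) (hLH : IsLerayHopfOn T ν 0 (u 0) u)
    (hdec : HasRapidSpatialDecay (u 0))
    {k₀ : ℝ → ℝ}
    (hmin : (∀ t ∈ Ico 0 T, ∀ c : ℝ, 0 ≤ c →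
      (∀ M : ℝ, (∀ x, ‖u t x‖ ≤ M) →
        |∫ x, ⟪curl (u t) x, fderiv ℝ (u t) x (curl (u t) x)⟫_ℝ| ≤
          c * M * Real.sqrt (∫ x, ‖curl (u t) x‖ ^ 2) *
            Real.sqrt (∫ x, frobeniusNormSq (fderiv ℝ (curl (u t)) x))) → k₀ t ≤ c)) :
    ∀ t ∈ Ico 0 T, k₀ t < sInf {κ : ℝ | (∀ (v : EuclideanSpace ℝ (Fin 3) → EuclideanSpace ℝ (Fin 3)) (M B : ℝ), ContDiff ℝ (⊤ : ℕ∞) v → Literature.Analysis.FluidPDE.VectorCalculus.IsDivFree v → (∀ x, ‖v x‖ ≤ M) → (∀ x, ‖fderiv ℝ v x‖ ≤ B) → (∫⁻ x, ‖iteratedFDeriv ℝ 0 v x‖ₑ ^ 2 < ⊤) → (∫⁻ x, ‖iteratedFDeriv ℝ 1 v x‖ₑ ^ 2 < ⊤) → (∫⁻ x, ‖iteratedFDeriv ℝ 2 v x‖ₑ ^ 2 < ⊤) → |∫ x, ⟪Literature.Analysis.FluidPDE.curl v x, fderiv ℝ v x (Literature.Analysis.FluidPDE.curl v x)⟫_ℝ|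 ≤ κ * M * Real.sqrt (∫ x, ‖Literature.Analysis.FluidPDE.curl v x‖ ^ 2) * Real.sqrt (∫ x, Literature.Analysis.FluidPDE.frobeniusNormSq (fderiv ℝ (Literature.Analysis.FluidPDE.curl v) x)))} := by
  intro t ht
  have hκpos : 0 < sInf {κ : ℝ | (∀ (v : EuclideanSpace ℝ (Fin 3) → EuclideanSpace ℝ (Fin 3)) (M B : ℝ), ContDiff ℝ (⊤ : ℕ∞) v → Literature.Analysis.FluidPDE.VectorCalculus.IsDivFree v → (∀ x, ‖v x‖ ≤ M) → (∀ x, ‖fderiv ℝ v x‖ ≤ B) → (∫⁻ x, ‖iteratedFDeriv ℝ 0 v x‖ₑ ^ 2 < ⊤) → (∫⁻ x, ‖iteratedFDeriv ℝ 1 v x‖ₑ ^ 2 < ⊤) → (∫⁻ x, ‖iteratedFDeriv ℝ 2 v x‖ₑ ^ 2 < ⊤) → |∫ x, ⟪Literature.Analysis.FluidPDE.curl v x, fderiv ℝ v x (Literature.Analysis.FluidPDE.curl v x)⟫_ℝ| ≤ κ * M * Real.sqrt (∫ x, ‖Literature.Analysis.FluidPDE.curl v x‖ ^ 2) * Real.sqrt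 (∫ x, Literature.Analysis.FluidPDE.frobeniusNormSq (fderiv ℝ (Literature.Analysis.FluidPDE.curl v) x)))} := lt_trans (by norm_num) sharpDepletion_gt
  -- admissibility of the slice `u t`
  have ht' : (t + T) / 2 ∈ Ioo 0 T := ⟨by linarith [ht.1], by linarith [ht.2]⟩
  obtain ⟨q, hsolt, hut, -, -⟩ := stub_taoCover hν hT hsol hLH hdec ht'
  have htI : t ∈ Icc 0 ((t + T) / 2) := ⟨ht.1, by linarith [ht.2]⟩
  obtain ⟨C₀, hC₀⟩ := hut 0
  obtain ⟨C₁, hC₁⟩ := hut 1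
  obtain ⟨C₂, hC₂⟩ := hut 2
  obtain ⟨B₁, -, hB₁⟩ := exists_forall_norm_fderiv_le_of_hasBoundedSobolevNormsOn
    (fun s hs => (hsolt.contDiff_velocity hs).of_le (by norm_cast)) hut
  obtain ⟨B₀, -, hB₀⟩ := exists_forall_norm_le_of_hasBoundedSobolevNormsOn hsolt hut
  have h0 : ∫⁻ x, ‖iteratedFDeriv ℝ 0 (u t) x‖ₑ ^ 2 < ⊤ := (hC₀ t htI).trans_lt ENNReal.coe_lt_top
  have h1 : ∫⁻ x, ‖iteratedFDeriv ℝ 1 (u t) x‖ₑ ^ 2 < ⊤ := (hC₁ t htI).trans_lt ENNReal.coe_lt_top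
  have h2 : ∫⁻ x, ‖iteratedFDeriv ℝ 2 (u t) x‖ₑ ^ 2 < ⊤ := (hC₂ t htI).trans_lt ENNReal.coe_lt_top
  have hcd : ContDiff ℝ (⊤ : ℕ∞) (u t) := hsol.contDiff_velocity ht
  have hdiv : VectorCalculus.IsDivFree (u t) := hsol.divFree t ht
  -- the least bound `N t = sup |u t|`
  obtain ⟨N, -, hN0, hN⟩ := exists_measurable_supNorm_slice (measurableSet_Ico (a := (0:ℝ)) (b := T))
    hsol.smooth_velocity.continuousOn
  obtain ⟨hNB, hNx⟩ := hN t ht B₀ (hB₀ t htI)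
  set Z : ℝ := ∫ x, ‖curl (u t) x‖ ^ 2 with hZ
  set P : ℝ := ∫ x, frobeniusNormSq (fderiv ℝ (curl (u t)) x) with hP
  set J : ℝ := ∫ x, ⟪curl (u t) x, fderiv ℝ (u t) x (curl (u t) x)⟫_ℝ with hJ
  set D : ℝ := N t * Real.sqrt Z * Real.sqrt P with hD
  have hD0 : 0 ≤ D := by rw [hD]; have := hN0 t; positivity
  -- universality of `κ⋆` at the least bound
  have hJle : |J| ≤ sInf {κ : ℝ | (∀ (v : EuclideanSpace ℝ (Fin 3) → EuclideanSpace ℝ (Fin 3)) (M B : ℝ), ContDiff ℝ (⊤ : ℕ∞) v → Literature.Analysis.FluidPDE.VectorCalculus.IsDivFree v → (∀ x, ‖v x‖ ≤ M) → (∀ x, ‖fderiv ℝ v x‖ ≤ B) → (∫⁻ x, ‖iteratedFDeriv ℝ 0 v x‖ₑ ^ 2 < ⊤) → (∫⁻ x, ‖iteratedFDeriv ℝ 1 v x‖ₑ ^ 2 < ⊤) → (∫⁻ x, ‖iteratedFDeriv ℝ 2 v x‖ₑ ^ 2 < ⊤) → |∫ x, ⟪Literature.Analysis.FluidPDE.curl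 v x, fderiv ℝ v x (Literature.Analysis.FluidPDE.curl v x)⟫_ℝ| ≤ κ * M * Real.sqrt (∫ x, ‖Literature.Analysis.FluidPDE.curl v x‖ ^ 2) * Real.sqrt (∫ x, Literature.Analysis.FluidPDE.frobeniusNormSq (fderiv ℝ (Literature.Analysis.FluidPDE.curl v) x)))} * N t * Real.sqrt Z * Real.sqrt P :=
    sharpDepletion_is_universal (u t) (N t) B₁ hcd hdiv hNx (hB₁ t htI) h0 h1 h2
  rcases hD0.eq_or_lt with hD00 | hDpos
  · -- degenerate slice: the clause holds with the constant `0`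
    have hJ0 : |J| ≤ 0 := by
      have : sInf {κ : ℝ | (∀ (v : EuclideanSpace ℝ (Fin 3) → EuclideanSpace ℝ (Fin 3)) (M B : ℝ), ContDiff ℝ (⊤ : ℕ∞) v → Literature.Analysis.FluidPDE.VectorCalculus.IsDivFree v → (∀ x, ‖v x‖ ≤ M) → (∀ x, ‖fderiv ℝ v x‖ ≤ B) → (∫⁻ x, ‖iteratedFDeriv ℝ 0 v x‖ₑ ^ 2 < ⊤) → (∫⁻ x, ‖iteratedFDeriv ℝ 1 v x‖ₑ ^ 2 < ⊤) → (∫⁻ x, ‖iteratedFDeriv ℝ 2 v x‖ₑ ^ 2 < ⊤) → |∫ x, ⟪Literature.Analysis.FluidPDE.curl v x, fderiv ℝ v x (Literature.Analysis.FluidPDE.curl v x)⟫_ℝ| ≤ κ * M * Real.sqrt (∫ x, ‖Literature.Analysis.FluidPDE.curl v x‖ ^ 2) * Real.sqrt (∫ x, Literature.Analysis.FluidPDE.frobeniusNormSq (fderiv ℝ (Literature.Analysis.FluidPDE.curl v) x)))} * N t * Real.sqrt Z * Real.sqrt P = sInf {κ : ℝ | (∀ (v : EuclideanSpace ℝ (Fin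 3) → EuclideanSpace ℝ (Fin 3)) (M B : ℝ), ContDiff ℝ (⊤ : ℕ∞) v → Literature.Analysis.FluidPDE.VectorCalculus.IsDivFree v → (∀ x, ‖v x‖ ≤ M) → (∀ x, ‖fderiv ℝ v x‖ ≤ B) → (∫⁻ x, ‖iteratedFDeriv ℝ 0 v x‖ₑ ^ 2 < ⊤) → (∫⁻ x, ‖iteratedFDeriv ℝ 1 v x‖ₑ ^ 2 < ⊤) → (∫⁻ x, ‖iteratedFDeriv ℝ 2 v x‖ₑ ^ 2 < ⊤) → |∫ x, ⟪Literature.Analysis.FluidPDE.curl v x, fderiv ℝ v x (Literature.Analysis.FluidPDE.curl v x)⟫_ℝ| ≤ κ * M * Real.sqrt (∫ x, ‖Literature.Analysis.FluidPDE.curl v x‖ ^ 2) * Real.sqrt (∫ x, Literature.Analysis.FluidPDE.frobeniusNormSq (fderiv ℝ (Literature.Analysis.FluidPDE.curl v) x)))} * D := by rw [hD]; ring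
      rw [this, ← hD00, mul_zero] at hJle
      exact hJle
    have hk : k₀ t ≤ 0 := by
      refine hmin t ht 0 le_rfl fun M hM => ?_
      have : (0 : ℝ) * M * Real.sqrt Z * Real.sqrt P = 0 := by ring
      rw [this]
      exact hJ0
    exact lt_of_le_of_lt hk hκpos
  · -- non-degenerate slice: the efficiency `|J|/D` is an admissible constant at `t`, and it is `< κ⋆` by `hna`
    have hlt : |J| < sInf {κ : ℝ | (∀ (v : EuclideanSpace ℝ (Fin 3) → EuclideanSpace ℝ (Fin 3)) (M B : ℝ), ContDiff ℝ (⊤ : ℕ∞) v → Literature.Analysis.FluidPDE.VectorCalculus.IsDivFree v → (∀ x, ‖v x‖ ≤ M) → (∀ x, ‖fderiv ℝ v x‖ ≤ B) → (∫⁻ x, ‖iteratedFDeriv ℝ 0 v x‖ₑ ^ 2 < ⊤) → (∫⁻ x, ‖iteratedFDeriv ℝ 1 v x‖ₑ ^ 2 < ⊤) → (∫⁻ x, ‖iteratedFDeriv ℝ 2 v x‖ₑ ^ 2 < ⊤) → |∫ x, ⟪Literature.Analysis.FluidPDE.curl v x, fderiv ℝ v x (Literature.Analysis.FluidPDE.curl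 v x)⟫_ℝ| ≤ κ * M * Real.sqrt (∫ x, ‖Literature.Analysis.FluidPDE.curl v x‖ ^ 2) * Real.sqrt (∫ x, Literature.Analysis.FluidPDE.frobeniusNormSq (fderiv ℝ (Literature.Analysis.FluidPDE.curl v) x)))} * N t * Real.sqrt Z * Real.sqrt P :=
      hna (u t) (N t) B₁ hcd hdiv hNx (hB₁ t htI) h0 h1 h2 (by rw [hD] at hDpos; exact hDpos)
    have hc0 : 0 ≤ |J| / D := div_nonneg (abs_nonneg _) hD0
    have hk : k₀ t ≤ |J| / D := by
      refine hmin t ht (|J| / D) hc0 fun M hM => ?_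
      obtain ⟨hNM, -⟩ := hN t ht M hM
      have hsq : 0 ≤ Real.sqrt Z * Real.sqrt P := by positivity
      calc |J| = |J| / D * D := by field_simp
        _ = |J| / D * N t * Real.sqrt Z * Real.sqrt P := by rw [hD]; ring
        _ ≤ |J| / D * M * Real.sqrt Z * Real.sqrt P := by
            have h1 := mul_le_mul_of_nonneg_left hNM hc0
            have h2 := mul_le_mul_of_nonneg_right h1 hsq
            simpa [mul_assoc] using h2
    have hlt' : |J| / D < sInf {κ : ℝ | (∀ (v : EuclideanSpace ℝ (Fin 3) → EuclideanSpace ℝ (Fin 3)) (M B : ℝ), ContDiff ℝ (⊤ : ℕ∞) v → Literature.Analysis.FluidPDE.VectorCalculus.IsDivFree v → (∀ x, ‖v x‖ ≤ M) → (∀ x, ‖fderiv ℝ v x‖ ≤ B) → (∫⁻ x, ‖iteratedFDeriv ℝ 0 v x‖ₑ ^ 2 < ⊤) → (∫⁻ x, ‖iteratedFDeriv ℝ 1 v x‖ₑ ^ 2 < ⊤) → (∫⁻ x, ‖iteratedFDeriv ℝ 2 v x‖ₑ ^ 2 < ⊤) → |∫ x, ⟪Literature.Analysis.FluidPDE.curl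 v x, fderiv ℝ v x (Literature.Analysis.FluidPDE.curl v x)⟫_ℝ| ≤ κ * M * Real.sqrt (∫ x, ‖Literature.Analysis.FluidPDE.curl v x‖ ^ 2) * Real.sqrt (∫ x, Literature.Analysis.FluidPDE.frobeniusNormSq (fderiv ℝ (Literature.Analysis.FluidPDE.curl v) x)))} := by
      rw [div_lt_iff₀ hDpos, hD]
      simpa [mul_assoc] using hlt
    exact lt_of_le_of_lt hk hlt'

/-- **Under non-attainment, the period mass of a DSS flow is strictly sub-extremal.** Same setting, `u` moreover
discretely self-similar about `T` with factor `c > 1`, `k₀ : ℝ → [0,1]` measurable, satisfying the clause on `[0,T)`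
and minimal there, `t₁ ∈ [0,T)`: `∫_{t₁}^{T−(T−t₁)/c²} k₀²/(T−τ) < κ⋆²·log(c²)` (the integrand is pointwise `<`
`κ⋆²/(T−τ)` on the block by `minimalCoeff_lt_sharp_of_notAttained`, and `∫_{block} κ⋆²/(T−τ) = κ⋆² log(c²)`).
[folklore] -/
theorem dss_periodMass_lt_of_notAttained
    (hna : (∀ (v : EuclideanSpace ℝ (Fin 3) → EuclideanSpace ℝ (Fin 3)) (M B : ℝ), ContDiff ℝ (⊤ : ℕ∞) v → Literature.Analysis.FluidPDE.VectorCalculus.IsDivFree v → (∀ x, ‖v x‖ ≤ M) → (∀ x, ‖fderiv ℝ v x‖ ≤ B) → (∫⁻ x, ‖iteratedFDeriv ℝ 0 v x‖ₑ ^ 2 < ⊤) → (∫⁻ x, ‖iteratedFDeriv ℝ 1 v x‖ₑ ^ 2 < ⊤) → (∫⁻ x, ‖iteratedFDeriv ℝ 2 v x‖ₑ ^ 2 < ⊤) → 0 < M * Real.sqrt (∫ x, ‖curl v x‖ ^ 2) * Real.sqrt (∫ x, frobeniusNormSq (fderiv ℝ (curl v) x)) → |∫ x, ⟪curl v x, fderiv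 ℝ v x (curl v x)⟫_ℝ| < (sInf {κ : ℝ | (∀ (v : EuclideanSpace ℝ (Fin 3) → EuclideanSpace ℝ (Fin 3)) (M B : ℝ), ContDiff ℝ (⊤ : ℕ∞) v → Literature.Analysis.FluidPDE.VectorCalculus.IsDivFree v → (∀ x, ‖v x‖ ≤ M) → (∀ x, ‖fderiv ℝ v x‖ ≤ B) → (∫⁻ x, ‖iteratedFDeriv ℝ 0 v x‖ₑ ^ 2 < ⊤) → (∫⁻ x, ‖iteratedFDeriv ℝ 1 v x‖ₑ ^ 2 < ⊤) → (∫⁻ x, ‖iteratedFDeriv ℝ 2 v x‖ₑ ^ 2 < ⊤) → |∫ x, ⟪Literature.Analysis.FluidPDE.curl v x, fderiv ℝ v x (Literature.Analysis.FluidPDE.curl v x)⟫_ℝ| ≤ κ * M * Real.sqrt (∫ x, ‖Literature.Analysis.FluidPDE.curl v x‖ ^ 2) * Real.sqrt (∫ x, Literature.Analysis.FluidPDE.frobeniusNormSq (fderiv ℝ (Literature.Analysis.FluidPDE.curl v) x)))}) * M * Real.sqrt (∫ x, ‖curl v x‖ ^ 2) * Real.sqrt (∫ x, frobeniusNormSq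 (fderiv ℝ (curl v) x))))
    {c ν T t₁ : ℝ} (hc : 1 < c) (hν : 0 < ν) (hT : 0 < T) (ht₁ : t₁ ∈ Ico 0 T)
    {u : ℝ → EuclideanSpace ℝ (Fin 3) → EuclideanSpace ℝ (Fin 3)} {p : ℝ → EuclideanSpace ℝ (Fin 3) → ℝ}
    (hsol : IsClassicalNSSolutionOn (Ico 0 T) ν 0 u p) (hLH : IsLerayHopfOn T ν 0 (u 0) u)
    (hdec : HasRapidSpatialDecay (u 0))
    {k₀ : ℝ → ℝ} (hk₀m : Measurable k₀) (hk₀01 : ∀ τ, 0 ≤ k₀ τ ∧ k₀ τ ≤ 1)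
    (hmin : (∀ t ∈ Ico 0 T, ∀ c : ℝ, 0 ≤ c →
      (∀ M : ℝ, (∀ x, ‖u t x‖ ≤ M) →
        |∫ x, ⟪curl (u t) x, fderiv ℝ (u t) x (curl (u t) x)⟫_ℝ| ≤
          c * M * Real.sqrt (∫ x, ‖curl (u t) x‖ ^ 2) *
            Real.sqrt (∫ x, frobeniusNormSq (fderiv ℝ (curl (u t)) x))) → k₀ t ≤ c)) :
    ∫ τ in t₁..(T - (T - t₁) / c ^ 2), k₀ τ ^ 2 / (T - τ) < sInf {κ : ℝ | (∀ (v : EuclideanSpace ℝ (Fin 3) → EuclideanSpace ℝ (Fin 3)) (M B : ℝ), ContDiff ℝ (⊤ : ℕ∞) v → Literature.Analysis.FluidPDE.VectorCalculus.IsDivFree v → (∀ x, ‖v x‖ ≤ M) → (∀ x, ‖fderiv ℝ v x‖ ≤ B) → (∫⁻ x, ‖iteratedFDeriv ℝ 0 v x‖ₑ ^ 2 < ⊤) → (∫⁻ x, ‖iteratedFDeriv ℝ 1 v x‖ₑ ^ 2 < ⊤) → (∫⁻ x, ‖iteratedFDeriv ℝ 2 v x‖ₑ ^ 2 < ⊤)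 → |∫ x, ⟪Literature.Analysis.FluidPDE.curl v x, fderiv ℝ v x (Literature.Analysis.FluidPDE.curl v x)⟫_ℝ| ≤ κ * M * Real.sqrt (∫ x, ‖Literature.Analysis.FluidPDE.curl v x‖ ^ 2) * Real.sqrt (∫ x, Literature.Analysis.FluidPDE.frobeniusNormSq (fderiv ℝ (Literature.Analysis.FluidPDE.curl v) x)))} ^ 2 * Real.log (c ^ 2) := by
  have hc0 : 0 < c := lt_trans one_pos hc
  have hc2 : 1 < c ^ 2 := by nlinarith
  have hTt₁ : 0 < T - t₁ := sub_pos.2 ht₁.2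
  have hκpos : 0 < sInf {κ : ℝ | (∀ (v : EuclideanSpace ℝ (Fin 3) → EuclideanSpace ℝ (Fin 3)) (M B : ℝ), ContDiff ℝ (⊤ : ℕ∞) v → Literature.Analysis.FluidPDE.VectorCalculus.IsDivFree v → (∀ x, ‖v x‖ ≤ M) → (∀ x, ‖fderiv ℝ v x‖ ≤ B) → (∫⁻ x, ‖iteratedFDeriv ℝ 0 v x‖ₑ ^ 2 < ⊤) → (∫⁻ x, ‖iteratedFDeriv ℝ 1 v x‖ₑ ^ 2 < ⊤) → (∫⁻ x, ‖iteratedFDeriv ℝ 2 v x‖ₑ ^ 2 < ⊤) → |∫ x, ⟪Literature.Analysis.FluidPDE.curl v x, fderiv ℝ v x (Literature.Analysis.FluidPDE.curl v x)⟫_ℝ| ≤ κ * M * Real.sqrt (∫ x, ‖Literature.Analysis.FluidPDE.curl v x‖ ^ 2) * Real.sqrt (∫ x, Literature.Analysis.FluidPDE.frobeniusNormSq (fderiv ℝ (Literature.Analysis.FluidPDE.curl v) x)))} := lt_trans (by norm_num) sharpDepletion_gt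
  set s₁ : ℝ := T - (T - t₁) / c ^ 2 with hs₁
  have hlt₁ : t₁ < s₁ := by
    have h : (T - t₁) / c ^ 2 < T - t₁ := div_lt_self hTt₁ hc2
    rw [hs₁]; linarith
  have hs₁T : s₁ < T := by
    have : 0 < (T - t₁) / c ^ 2 := div_pos hTt₁ (by positivity)
    rw [hs₁]; linarith
  -- the constant block mass `κ⋆² log(c²)`
  have hconst : ∫ τ in t₁..s₁, sInf {κ : ℝ | (∀ (v : EuclideanSpace ℝ (Fin 3) → EuclideanSpace ℝ (Fin 3)) (M B : ℝ), ContDiff ℝ (⊤ : ℕ∞) v → Literature.Analysis.FluidPDE.VectorCalculus.IsDivFree v → (∀ x, ‖v x‖ ≤ M) → (∀ x, ‖fderiv ℝ v x‖ ≤ B) → (∫⁻ x, ‖iteratedFDeriv ℝ 0 v x‖ₑ ^ 2 < ⊤) → (∫⁻ x, ‖iteratedFDeriv ℝ 1 v x‖ₑ ^ 2 < ⊤) → (∫⁻ x, ‖iteratedFDeriv ℝ 2 v x‖ₑ ^ 2 < ⊤) → |∫ x, ⟪Literature.Analysis.FluidPDE.curl v x, fderiv ℝ v x (Literature.Analysis.FluidPDE.curl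 v x)⟫_ℝ| ≤ κ * M * Real.sqrt (∫ x, ‖Literature.Analysis.FluidPDE.curl v x‖ ^ 2) * Real.sqrt (∫ x, Literature.Analysis.FluidPDE.frobeniusNormSq (fderiv ℝ (Literature.Analysis.FluidPDE.curl v) x)))} ^ 2 / (T - τ) = sInf {κ : ℝ | (∀ (v : EuclideanSpace ℝ (Fin 3) → EuclideanSpace ℝ (Fin 3)) (M B : ℝ), ContDiff ℝ (⊤ : ℕ∞) v → Literature.Analysis.FluidPDE.VectorCalculus.IsDivFree v → (∀ x, ‖v x‖ ≤ M) → (∀ x, ‖fderiv ℝ v x‖ ≤ B) → (∫⁻ x, ‖iteratedFDeriv ℝ 0 v x‖ₑ ^ 2 < ⊤) → (∫⁻ x, ‖iteratedFDeriv ℝ 1 v x‖ₑ ^ 2 < ⊤) → (∫⁻ x, ‖iteratedFDeriv ℝ 2 v x‖ₑ ^ 2 < ⊤) → |∫ x, ⟪Literature.Analysis.FluidPDE.curl v x, fderiv ℝ v x (Literature.Analysis.FluidPDE.curl v x)⟫_ℝ| ≤ κ * M * Real.sqrt (∫ x, ‖Literature.Analysis.FluidPDE.curl v x‖ ^ 2)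 * Real.sqrt (∫ x, Literature.Analysis.FluidPDE.frobeniusNormSq (fderiv ℝ (Literature.Analysis.FluidPDE.curl v) x)))} ^ 2 * Real.log (c ^ 2) := by
    rw [integral_const_div_sub hlt₁.le hs₁T]
    congr 1
    rw [hs₁, show T - (T - (T - t₁) / c ^ 2) = (T - t₁) / c ^ 2 by ring,
      div_div_eq_mul_div, mul_div_cancel_left₀ (c ^ 2) hTt₁.ne']
  -- strict inequality of the integrals: the difference has a positive integrand
  have hlt := minimalCoeff_lt_sharp_of_notAttained hna hν hT hsol hLH hdec hmin
  have hik : IntervalIntegrable (fun τ => k₀ τ ^ 2 / (T - τ)) volume t₁ s₁ :=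
    intervalIntegrable_coeff_sq_div hk₀m hk₀01 hlt₁.le hs₁T
  have hiK : IntervalIntegrable (fun τ => sInf {κ : ℝ | (∀ (v : EuclideanSpace ℝ (Fin 3) → EuclideanSpace ℝ (Fin 3)) (M B : ℝ), ContDiff ℝ (⊤ : ℕ∞) v → Literature.Analysis.FluidPDE.VectorCalculus.IsDivFree v → (∀ x, ‖v x‖ ≤ M) → (∀ x, ‖fderiv ℝ v x‖ ≤ B) → (∫⁻ x, ‖iteratedFDeriv ℝ 0 v x‖ₑ ^ 2 < ⊤) → (∫⁻ x, ‖iteratedFDeriv ℝ 1 v x‖ₑ ^ 2 < ⊤) → (∫⁻ x, ‖iteratedFDeriv ℝ 2 v x‖ₑ ^ 2 < ⊤) → |∫ x, ⟪Literature.Analysis.FluidPDE.curl v x, fderiv ℝ v x (Literature.Analysis.FluidPDE.curl v x)⟫_ℝ| ≤ κ * M * Real.sqrt (∫ x, ‖Literature.Analysis.FluidPDE.curl v x‖ ^ 2) * Real.sqrt (∫ x, Literature.Analysis.FluidPDE.frobeniusNormSq (fderiv ℝ (Literature.Analysis.FluidPDE.curl v) x)))} ^ 2 / (T - τ)) volume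 t₁ s₁ := by
    refine (ContinuousOn.intervalIntegrable ?_)
    refine ContinuousOn.div continuousOn_const (continuousOn_const.sub continuousOn_id) fun τ hτ => ?_
    rw [uIcc_of_le hlt₁.le] at hτ
    exact (sub_pos.2 (lt_of_le_of_lt hτ.2 hs₁T)).ne'
  have hpos : 0 < ∫ τ in t₁..s₁, (sInf {κ : ℝ | (∀ (v : EuclideanSpace ℝ (Fin 3) → EuclideanSpace ℝ (Fin 3)) (M B : ℝ), ContDiff ℝ (⊤ : ℕ∞) v → Literature.Analysis.FluidPDE.VectorCalculus.IsDivFree v → (∀ x, ‖v x‖ ≤ M) → (∀ x, ‖fderiv ℝ v x‖ ≤ B) → (∫⁻ x, ‖iteratedFDeriv ℝ 0 v x‖ₑ ^ 2 < ⊤) → (∫⁻ x, ‖iteratedFDeriv ℝ 1 v x‖ₑ ^ 2 < ⊤) → (∫⁻ x, ‖iteratedFDeriv ℝ 2 v x‖ₑ ^ 2 < ⊤) → |∫ x, ⟪Literature.Analysis.FluidPDE.curl v x, fderiv ℝ v x (Literature.Analysis.FluidPDE.curl v x)⟫_ℝ| ≤ κ * M * Real.sqrt (∫ x, ‖Literature.Analysis.FluidPDE.curl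 v x‖ ^ 2) * Real.sqrt (∫ x, Literature.Analysis.FluidPDE.frobeniusNormSq (fderiv ℝ (Literature.Analysis.FluidPDE.curl v) x)))} ^ 2 / (T - τ) - k₀ τ ^ 2 / (T - τ)) := by
    refine intervalIntegral.intervalIntegral_pos_of_pos_on (hiK.sub hik) (fun τ hτ => ?_) hlt₁
    have hτT : τ ∈ Ico 0 T := ⟨ht₁.1.trans hτ.1.le, lt_trans hτ.2 hs₁T⟩
    have hTτ : 0 < T - τ := sub_pos.2 hτT.2
    have hk := hlt τ hτT
    have hk0 := (hk₀01 τ).1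
    rw [← sub_div]
    exact div_pos (by nlinarith) hTτ
  rw [intervalIntegral.integral_sub hiK hik, hconst] at hpos
  linarith

/-- **FLOW BY FLOW, THE DSS STRATUM IS LOG-MEAN SUB-EXTREMAL IF `κ⋆` IS NOT ATTAINED.** Same setting
(`hna`; `u` a classical Leray–Hopf rapidly-decaying-datum flow on `[0,T)`, discretely self-similar about `T` with
factor `c > 1`; `k₀` a measurable minimal flow-wise coefficient on `[0,T)`; onset `t₁ ∈ [0,T)`). Then there is
`θ ∈ [0,1)` — depending on the flow — with
`∫_{t₁}^t k₀²/(T−τ) ≤ (θκ⋆)²·log((T−t₁)/(T−t)) + I₀` for all `t ∈ [t₁,T)`, `I₀` the period mass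
(`(θκ⋆)² = I₀/log(c²) < κ⋆²` by `dss_periodMass_lt_of_notAttained`; the bound is `logMean_le_periodAverage_of_dss`).
What the crux's BC5 rung asks beyond this is ONE `θ` for ALL such flows. [folklore] -/
theorem dss_perFlow_logMean_of_notAttained
    (hna : (∀ (v : EuclideanSpace ℝ (Fin 3) → EuclideanSpace ℝ (Fin 3)) (M B : ℝ), ContDiff ℝ (⊤ : ℕ∞) v → Literature.Analysis.FluidPDE.VectorCalculus.IsDivFree v → (∀ x, ‖v x‖ ≤ M) → (∀ x, ‖fderiv ℝ v x‖ ≤ B) → (∫⁻ x, ‖iteratedFDeriv ℝ 0 v x‖ₑ ^ 2 < ⊤) → (∫⁻ x, ‖iteratedFDeriv ℝ 1 v x‖ₑ ^ 2 < ⊤) → (∫⁻ x, ‖iteratedFDeriv ℝ 2 v x‖ₑ ^ 2 < ⊤) → 0 < M * Real.sqrt (∫ x, ‖curl v x‖ ^ 2) * Real.sqrt (∫ x, frobeniusNormSq (fderiv ℝ (curl v) x)) → |∫ x, ⟪curl v x, fderiv ℝ v x (curl v x)⟫_ℝ| < (sInf {κ : ℝ | (∀ (v : EuclideanSpace ℝ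 (Fin 3) → EuclideanSpace ℝ (Fin 3)) (M B : ℝ), ContDiff ℝ (⊤ : ℕ∞) v → Literature.Analysis.FluidPDE.VectorCalculus.IsDivFree v → (∀ x, ‖v x‖ ≤ M) → (∀ x, ‖fderiv ℝ v x‖ ≤ B) → (∫⁻ x, ‖iteratedFDeriv ℝ 0 v x‖ₑ ^ 2 < ⊤) → (∫⁻ x, ‖iteratedFDeriv ℝ 1 v x‖ₑ ^ 2 < ⊤) → (∫⁻ x, ‖iteratedFDeriv ℝ 2 v x‖ₑ ^ 2 < ⊤) → |∫ x, ⟪Literature.Analysis.FluidPDE.curl v x, fderiv ℝ v x (Literature.Analysis.FluidPDE.curl v x)⟫_ℝ| ≤ κ * M * Real.sqrt (∫ x, ‖Literature.Analysis.FluidPDE.curl v x‖ ^ 2) * Real.sqrt (∫ x, Literature.Analysis.FluidPDE.frobeniusNormSq (fderiv ℝ (Literature.Analysis.FluidPDE.curl v) x)))}) * M * Real.sqrt (∫ x, ‖curl v x‖ ^ 2) * Real.sqrt (∫ x, frobeniusNormSq (fderiv ℝ (curl v) x))))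
    {c ν T t₁ : ℝ} (hc : 1 < c) (hν : 0 < ν) (hT : 0 < T) (ht₁ : t₁ ∈ Ico 0 T)
    {u : ℝ → EuclideanSpace ℝ (Fin 3) → EuclideanSpace ℝ (Fin 3)} {p : ℝ → EuclideanSpace ℝ (Fin 3) → ℝ}
    (hsol : IsClassicalNSSolutionOn (Ico 0 T) ν 0 u p) (hLH : IsLerayHopfOn T ν 0 (u 0) u)
    (hdec : HasRapidSpatialDecay (u 0))
    (hdss : IsDiscretelySelfSimilar c (fun s x => u (T + s) x))
    {k₀ : ℝ → ℝ} (hk₀m : Measurable k₀) (hk₀01 : ∀ τ, 0 ≤ k₀ τ ∧ k₀ τ ≤ 1)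
    (hcl : (∀ t ∈ Ico 0 T, ∀ M : ℝ, (∀ x, ‖u t x‖ ≤ M) →
      |∫ x, ⟪curl (u t) x, fderiv ℝ (u t) x (curl (u t) x)⟫_ℝ| ≤
        k₀ t * M * Real.sqrt (∫ x, ‖curl (u t) x‖ ^ 2) *
          Real.sqrt (∫ x, frobeniusNormSq (fderiv ℝ (curl (u t)) x))))
    (hmin : (∀ t ∈ Ico 0 T, ∀ c : ℝ, 0 ≤ c →
      (∀ M : ℝ, (∀ x, ‖u t x‖ ≤ M) →
        |∫ x, ⟪curl (u t) x, fderiv ℝ (u t) x (curl (u t) x)⟫_ℝ| ≤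
          c * M * Real.sqrt (∫ x, ‖curl (u t) x‖ ^ 2) *
            Real.sqrt (∫ x, frobeniusNormSq (fderiv ℝ (curl (u t)) x))) → k₀ t ≤ c)) :
    ∃ θ : ℝ, 0 ≤ θ ∧ θ < 1 ∧ ∀ t ∈ Ico t₁ T, ∫ τ in t₁..t, k₀ τ ^ 2 / (T - τ) ≤
      (θ * sInf {κ : ℝ | (∀ (v : EuclideanSpace ℝ (Fin 3) → EuclideanSpace ℝ (Fin 3)) (M B : ℝ), ContDiff ℝ (⊤ : ℕ∞) v → Literature.Analysis.FluidPDE.VectorCalculus.IsDivFree v → (∀ x, ‖v x‖ ≤ M) → (∀ x, ‖fderiv ℝ v x‖ ≤ B) → (∫⁻ x, ‖iteratedFDeriv ℝ 0 v x‖ₑ ^ 2 < ⊤) → (∫⁻ x, ‖iteratedFDeriv ℝ 1 v x‖ₑ ^ 2 < ⊤) → (∫⁻ x, ‖iteratedFDeriv ℝ 2 v x‖ₑ ^ 2 < ⊤) → |∫ x, ⟪Literature.Analysis.FluidPDE.curl v x, fderiv ℝ v x (Literature.Analysis.FluidPDE.curl v x)⟫_ℝ| ≤ κ * M * Real.sqrt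 (∫ x, ‖Literature.Analysis.FluidPDE.curl v x‖ ^ 2) * Real.sqrt (∫ x, Literature.Analysis.FluidPDE.frobeniusNormSq (fderiv ℝ (Literature.Analysis.FluidPDE.curl v) x)))}) ^ 2 * Real.log ((T - t₁) / (T - t)) +
        ∫ τ in t₁..(T - (T - t₁) / c ^ 2), k₀ τ ^ 2 / (T - τ) := by
  have hc0 : 0 < c := lt_trans one_pos hc
  have hc2 : 1 < c ^ 2 := by nlinarith
  have hℓ : 0 < Real.log (c ^ 2) := Real.log_pos hc2
  have hκpos : 0 < sInf {κ : ℝ | (∀ (v : EuclideanSpace ℝ (Fin 3) → EuclideanSpace ℝ (Fin 3)) (M B : ℝ), ContDiff ℝ (⊤ : ℕ∞) v → Literature.Analysis.FluidPDE.VectorCalculus.IsDivFree v → (∀ x, ‖v x‖ ≤ M) → (∀ x, ‖fderiv ℝ v x‖ ≤ B) → (∫⁻ x, ‖iteratedFDeriv ℝ 0 v x‖ₑ ^ 2 < ⊤) → (∫⁻ x, ‖iteratedFDeriv ℝ 1 v x‖ₑ ^ 2 < ⊤) → (∫⁻ x, ‖iteratedFDeriv ℝ 2 v x‖ₑ ^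 2 < ⊤) → |∫ x, ⟪Literature.Analysis.FluidPDE.curl v x, fderiv ℝ v x (Literature.Analysis.FluidPDE.curl v x)⟫_ℝ| ≤ κ * M * Real.sqrt (∫ x, ‖Literature.Analysis.FluidPDE.curl v x‖ ^ 2) * Real.sqrt (∫ x, Literature.Analysis.FluidPDE.frobeniusNormSq (fderiv ℝ (Literature.Analysis.FluidPDE.curl v) x)))} := lt_trans (by norm_num) sharpDepletion_gt
  set I₀ : ℝ := ∫ τ in t₁..(T - (T - t₁) / c ^ 2), k₀ τ ^ 2 / (T - τ) with hI₀
  have hTt₁ : 0 < T - t₁ := sub_pos.2 ht₁.2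
  have hs1 : t₁ ≤ T - (T - t₁) / c ^ 2 := by
    have h : (T - t₁) / c ^ 2 ≤ T - t₁ := div_le_self hTt₁.le hc2.le
    linarith
  have hI₀0 : 0 ≤ I₀ :=
    intervalIntegral.integral_nonneg hs1 fun τ hτ => div_nonneg (sq_nonneg _) (by
      have : 0 < (T - t₁) / c ^ 2 := div_pos hTt₁ (by positivity)
      linarith [hτ.2])
  have hIlt : I₀ < sInf {κ : ℝ | (∀ (v : EuclideanSpace ℝ (Fin 3) → EuclideanSpace ℝ (Fin 3)) (M B : ℝ), ContDiff ℝ (⊤ : ℕ∞) v → Literature.Analysis.FluidPDE.VectorCalculus.IsDivFree v → (∀ x, ‖v x‖ ≤ M) → (∀ x, ‖fderiv ℝ v x‖ ≤ B) → (∫⁻ x, ‖iteratedFDeriv ℝ 0 v x‖ₑ ^ 2 < ⊤) → (∫⁻ x, ‖iteratedFDeriv ℝ 1 v x‖ₑ ^ 2 < ⊤) → (∫⁻ x, ‖iteratedFDeriv ℝ 2 v x‖ₑ ^ 2 < ⊤) → |∫ x, ⟪Literature.Analysis.FluidPDE.curl v x, fderiv ℝ v x (Literature.Analysis.FluidPDE.curl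 v x)⟫_ℝ| ≤ κ * M * Real.sqrt (∫ x, ‖Literature.Analysis.FluidPDE.curl v x‖ ^ 2) * Real.sqrt (∫ x, Literature.Analysis.FluidPDE.frobeniusNormSq (fderiv ℝ (Literature.Analysis.FluidPDE.curl v) x)))} ^ 2 * Real.log (c ^ 2) :=
    dss_periodMass_lt_of_notAttained hna hc hν hT ht₁ hsol hLH hdec hk₀m hk₀01 hmin
  set A : ℝ := I₀ / Real.log (c ^ 2) with hA
  have hA0 : 0 ≤ A := div_nonneg hI₀0 hℓ.le
  have hAlt : A < sInf {κ : ℝ | (∀ (v : EuclideanSpace ℝ (Fin 3) → EuclideanSpace ℝ (Fin 3)) (M B : ℝ), ContDiff ℝ (⊤ : ℕ∞) v → Literature.Analysis.FluidPDE.VectorCalculus.IsDivFree v → (∀ x, ‖v x‖ ≤ M) → (∀ x, ‖fderiv ℝ v x‖ ≤ B) → (∫⁻ x, ‖iteratedFDeriv ℝ 0 v x‖ₑ ^ 2 < ⊤) → (∫⁻ x, ‖iteratedFDeriv ℝ 1 v x‖ₑ ^ 2 < ⊤) → (∫⁻ x, ‖iteratedFDeriv ℝ 2 v x‖ₑ ^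 2 < ⊤) → |∫ x, ⟪Literature.Analysis.FluidPDE.curl v x, fderiv ℝ v x (Literature.Analysis.FluidPDE.curl v x)⟫_ℝ| ≤ κ * M * Real.sqrt (∫ x, ‖Literature.Analysis.FluidPDE.curl v x‖ ^ 2) * Real.sqrt (∫ x, Literature.Analysis.FluidPDE.frobeniusNormSq (fderiv ℝ (Literature.Analysis.FluidPDE.curl v) x)))} ^ 2 := by rw [hA, div_lt_iff₀ hℓ]; exact hIlt
  refine ⟨Real.sqrt A / sInf {κ : ℝ | (∀ (v : EuclideanSpace ℝ (Fin 3) → EuclideanSpace ℝ (Fin 3)) (M B : ℝ), ContDiff ℝ (⊤ : ℕ∞) v → Literature.Analysis.FluidPDE.VectorCalculus.IsDivFree v → (∀ x, ‖v x‖ ≤ M) → (∀ x, ‖fderiv ℝ v x‖ ≤ B) → (∫⁻ x, ‖iteratedFDeriv ℝ 0 v x‖ₑ ^ 2 < ⊤) → (∫⁻ x, ‖iteratedFDeriv ℝ 1 v x‖ₑ ^ 2 < ⊤) → (∫⁻ x, ‖iteratedFDeriv ℝ 2 v x‖ₑ ^ 2 < ⊤) → |∫ x, ⟪Literature.Analysis.FluidPDE.curl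 v x, fderiv ℝ v x (Literature.Analysis.FluidPDE.curl v x)⟫_ℝ| ≤ κ * M * Real.sqrt (∫ x, ‖Literature.Analysis.FluidPDE.curl v x‖ ^ 2) * Real.sqrt (∫ x, Literature.Analysis.FluidPDE.frobeniusNormSq (fderiv ℝ (Literature.Analysis.FluidPDE.curl v) x)))}, div_nonneg (Real.sqrt_nonneg _) hκpos.le, ?_, ?_⟩
  · rw [div_lt_one hκpos, Real.sqrt_lt' hκpos]
    exact hAlt
  · intro t ht
    have hsq : (Real.sqrt A / sInf {κ : ℝ | (∀ (v : EuclideanSpace ℝ (Fin 3) → EuclideanSpace ℝ (Fin 3)) (M B : ℝ), ContDiff ℝ (⊤ : ℕ∞) v → Literature.Analysis.FluidPDE.VectorCalculus.IsDivFree v → (∀ x, ‖v x‖ ≤ M) → (∀ x, ‖fderiv ℝ v x‖ ≤ B) → (∫⁻ x, ‖iteratedFDeriv ℝ 0 v x‖ₑ ^ 2 < ⊤) → (∫⁻ x, ‖iteratedFDeriv ℝ 1 v x‖ₑ ^ 2 < ⊤) → (∫⁻ x, ‖iteratedFDeriv ℝ 2 v x‖ₑ ^ 2 < ⊤) → |∫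 x, ⟪Literature.Analysis.FluidPDE.curl v x, fderiv ℝ v x (Literature.Analysis.FluidPDE.curl v x)⟫_ℝ| ≤ κ * M * Real.sqrt (∫ x, ‖Literature.Analysis.FluidPDE.curl v x‖ ^ 2) * Real.sqrt (∫ x, Literature.Analysis.FluidPDE.frobeniusNormSq (fderiv ℝ (Literature.Analysis.FluidPDE.curl v) x)))} * sInf {κ : ℝ | (∀ (v : EuclideanSpace ℝ (Fin 3) → EuclideanSpace ℝ (Fin 3)) (M B : ℝ), ContDiff ℝ (⊤ : ℕ∞) v → Literature.Analysis.FluidPDE.VectorCalculus.IsDivFree v → (∀ x, ‖v x‖ ≤ M) → (∀ x, ‖fderiv ℝ v x‖ ≤ B) → (∫⁻ x, ‖iteratedFDeriv ℝ 0 v x‖ₑ ^ 2 < ⊤) → (∫⁻ x, ‖iteratedFDeriv ℝ 1 v x‖ₑ ^ 2 < ⊤) → (∫⁻ x, ‖iteratedFDeriv ℝ 2 v x‖ₑ ^ 2 < ⊤) → |∫ x, ⟪Literature.Analysis.FluidPDE.curl v x, fderiv ℝ v x (Literature.Analysis.FluidPDE.curl v x)⟫_ℝ| ≤ κ * M * Real.sqrt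 (∫ x, ‖Literature.Analysis.FluidPDE.curl v x‖ ^ 2) * Real.sqrt (∫ x, Literature.Analysis.FluidPDE.frobeniusNormSq (fderiv ℝ (Literature.Analysis.FluidPDE.curl v) x)))}) ^ 2 = A := by
      rw [div_mul_cancel₀ _ hκpos.ne', Real.sq_sqrt hA0]
    rw [hsq, hA]
    exact logMean_le_periodAverage_of_dss hc hT ht₁ hdss hk₀m hk₀01 hcl hmin t ht

end DepletionLadder

end Summit.NavierStokesRegularity.NavierStokesRegularity.Theorems

end
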